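import Mathlib.RingTheory.DedekindDomain.Different
import Mathlib.RingTheory.Localization.Integral
import Mathlib.RingTheory.Norm.Basic
import Literature.NumberTheory.DiophantineGeometry.GenEllConductorDifferent
import HarnessLib

/-!
# The log-different of a simple extension generated by a root of a FIXED integer polynomial

Classical algebraic number theory (the "elementary theory of differents", as invoked in S. Mochizuki,
*Arithmetic elliptic curves in general position*, Math. J. Okayama Univ. 52 (2010), proof of Prop. 1.7 (i)
p. 10 and of Thm. 2.1 p. 12 [cite: MochizukiGenEll2010, Thm 2.1 p.12]; J. Neukirch, *Algebraic Number
Theory* (1999), Ch. III §2, (2.4)–(2.5): `f'(θ) ∈ 𝔇_{L'/L}` for `L' = L(θ)`, `θ` integral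
[cite: NeukirchANT1999, Ch. III (2.4) p.197]).

**Statement proved.** Fix a polynomial `μ ∈ ℤ[X]` that is MONIC and SEPARABLE over `ℚ`. There is a
constant `D = D(μ) ≥ 0` such that for every extension of number fields `L ⊆ L'` GENERATED over `L` by a
root `θ ∈ L'` of `μ` one has

`(1/[L':ℚ])·log|disc L'| ≤ (1/[L:ℚ])·log|disc L| + D`

(`exists_logdisc_adjoin_root_le`), together with the `NFPoint.logDiff` form used by the GenEllTwo assembly
(`exists_logDiff_adjoin_root_le`: `log-diff(Q') ≤ log-diff(Q) + D` whenever `Q'.F = Q.F(θ)`, `μ(θ) = 0`).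
In fact `D = log N` for any nonzero integer `N` with `N ∈ B(X)·μ'(X) + ℤ[X]·μ(X)` (`B ∈ ℤ[X]`), which
exists because `μ` is separable over `ℚ` (Bézout in `ℚ[X]`, denominators cleared).

**Proof.** (1) `exists_int_bezout_derivative`: from `gcd(μ, μ') = 1` in `ℚ[X]` an identity
`B·μ' ≡ N (mod μ)` with `B ∈ ℤ[X]`, `N ∈ ℤ ∖ 0`, hence `B(θ)·μ'(θ) = N` at every root `θ` of `μ` in a
`ℚ`-algebra. (2) `aeval_derivative_int_mem_differentIdeal`: `θ` is integral, `L' = L(θ)`, so Mathlib's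
`aeval_derivative_mem_differentIdeal` gives `f'(θ) ∈ 𝔇_{L'/L}` for `f = minpoly_{𝓞_L}(θ)`; as `f ∣ μ`
(`minpoly.isIntegrallyClosed_dvd`), `μ' = f'g + fg'` and `μ'(θ) = f'(θ)g(θ) ∈ 𝔇_{L'/L}`. (3) Hence
`N ∈ 𝔇_{L'/L}`, so `N(𝔇_{L'/L}) ∣ |N_{L'/ℚ}(N)| = |N|^{[L':ℚ]}` and `log N(𝔇_{L'/L}) ≤ [L':ℚ]·log|N|`
(`log_absNorm_differentIdeal_le`). (4) Transitivity of the different/discriminant (the tree's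
`log_natAbs_discr_eq`: `log|disc L'| = log N(𝔇_{L'/L}) + [L':L]·log|disc L|`) and `[L':ℚ] = [L':L][L:ℚ]`.

Proof-only file (theorems only, no definitions, no named facts), supporting the GenEllTwo assembly
(abc-iut cell, stmt-ABC-19679, helper J-A of abc-iut-w5-d075's mechanism assembly: the per-point field
`L' = ℚ(x, r)(θ)` with `θ` a root of a FIXED `μ`). Classical and undisputed; nothing here bears on
[IUTchIII] Cor. 3.12.
-/

noncomputable section

open NumberField IsDedekindDomain Ideal Module Polynomial

namespace Literature.NumberTheory.DiophantineGeometry.GenEll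

/-! ### (1) An integer Bézout identity against `μ'` modulo `μ` -/

/-- For `μ ∈ ℤ[X]` separable over `ℚ` there are `N ∈ ℤ ∖ 0` and `B ∈ ℤ[X]` with `B(θ)·μ'(θ) = N` at
every root `θ` of `μ` in any commutative `ℚ`-algebra (Bézout `aμ + bμ' = 1` in `ℚ[X]`, denominators of `b`
cleared by Mathlib's `IsLocalization.integerNormalization`). [cite: NeukirchANT1999, Ch. III (2.4) p.197] -/
theorem exists_int_bezout_derivative (μ : ℤ[X]) (hsep : (μ.map (Int.castRingHom ℚ)).Separable) :
    ∃ (N : ℤ) (B : ℤ[X]), N ≠ 0 ∧ ∀ (S : Type*) [CommRing S] [Algebra ℚ S] (θ : S),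
      aeval θ μ = 0 → aeval θ B * aeval θ (derivative μ) = N := by
  obtain ⟨a, b, hab⟩ := hsep
  obtain ⟨β, hβ, hB⟩ := IsLocalization.integerNormalization_spec (nonZeroDivisors ℤ) b
  refine ⟨β, IsLocalization.integerNormalization (nonZeroDivisors ℤ) b,
    nonZeroDivisors.ne_zero hβ, fun S _ _ θ hθ => ?_⟩
  -- evaluate the Bézout identity at `θ`
  have hμ : aeval θ (μ.map (Int.castRingHom ℚ)) = 0 := by
    rw [show Int.castRingHom ℚ = algebraMap ℤ ℚ from rfl, aeval_map_algebraMap, hθ]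
  have hμ' : aeval θ (derivative (μ.map (Int.castRingHom ℚ))) = aeval θ (derivative μ) := by
    rw [derivative_map, show Int.castRingHom ℚ = algebraMap ℤ ℚ from rfl, aeval_map_algebraMap]
  have h1 : aeval θ b * aeval θ (derivative μ) = 1 := by
    have := congrArg (aeval θ) hab
    rw [map_add, map_mul, map_mul, hμ, mul_zero, zero_add, map_one, hμ'] at this
    exact this
  -- the integer polynomial `B = β·b`
  have hBθ : aeval θ (IsLocalization.integerNormalization (nonZeroDivisors ℤ) b) =
      β • aeval θ b := by
    rw [← aeval_map_algebraMap ℚ θ (IsLocalization.integerNormalization (nonZeroDivisors ℤ) b), hB,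
      ← IsScalarTower.algebraMap_smul ℚ β b, map_smul, IsScalarTower.algebraMap_smul]
  rw [hBθ, smul_mul_assoc, h1]
  simp

/-! ### (2) `N ∈ 𝔇_{L'/L}` for `L' = L(θ)`, `μ(θ) = 0` -/

section Different

variable (L L' : Type*) [Field L] [NumberField L] [Field L'] [NumberField L'] [Algebra L L']

/-- For `θ ∈ 𝓞_{L'}` a root of `μ ∈ ℤ[X]` with `L' = L(θ)`: `μ'(θ) ∈ 𝔇_{L'/L}` — Mathlib's
`aeval_derivative_mem_differentIdeal` (`f'(θ) ∈ 𝔇` for the minimal polynomial `f` of `θ` over `𝓞_L`)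
and `f ∣ μ` (`minpoly.isIntegrallyClosed_dvd`), `μ'(θ) = f'(θ)·g(θ)`. [cite: NeukirchANT1999, Ch. III (2.4) p.197] -/
theorem aeval_derivative_int_mem_differentIdeal (μ : ℤ[X]) (θ : 𝓞 L') (hθ : aeval θ μ = 0)
    (htop : IntermediateField.adjoin L {(θ : L')} = ⊤) :
    aeval θ (derivative μ) ∈ differentIdeal (𝓞 L) (𝓞 L') := by
  have hint : IsIntegral (𝓞 L) θ := Algebra.IsIntegral.isIntegral θ
  -- `L' = L(θ)` as an `L`-algebra
  have hx : Algebra.adjoin L {algebraMap (𝓞 L') L' θ} = ⊤ := by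
    have hθL : IsIntegral L (θ : L') := Algebra.IsIntegral.isIntegral _
    rw [show algebraMap (𝓞 L') L' θ = (θ : L') from rfl,
      ← IntermediateField.adjoin_simple_toSubalgebra_of_isAlgebraic hθL.isAlgebraic, htop,
      IntermediateField.top_toSubalgebra]
  have hf' : aeval θ (derivative (minpoly (𝓞 L) θ)) ∈ differentIdeal (𝓞 L) (𝓞 L') :=
    aeval_derivative_mem_differentIdeal (𝓞 L) L L' θ hx
  -- `minpoly ∣ μ`
  have hμA : aeval θ (μ.map (algebraMap ℤ (𝓞 L))) = 0 := by rw [aeval_map_algebraMap, hθ]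
  obtain ⟨g, hg⟩ := minpoly.isIntegrallyClosed_dvd hint hμA
  have hder : aeval θ (derivative μ) =
      aeval θ (derivative (minpoly (𝓞 L) θ)) * aeval θ g := by
    have h := congrArg (fun q => aeval θ (derivative q)) hg
    rw [derivative_map, aeval_map_algebraMap, derivative_mul, map_add, map_mul, map_mul,
      minpoly.aeval, zero_mul, add_zero] at h
    exact h
  rw [hder]
  exact Ideal.mul_mem_right _ _ hf'

/-- **`log N(𝔇_{L'/L}) ≤ [L':ℚ]·log N`** whenever a nonzero integer `N` lies in the relative different
(`N(𝔇) ∣ |N_{L'/ℚ}(N)| = |N|^{[L':ℚ]}`). [cite: NeukirchANT1999, Ch. III (2.5) p.198] -/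
theorem log_absNorm_differentIdeal_le {N : ℤ} (hN : N ≠ 0)
    (hmem : (N : 𝓞 L') ∈ differentIdeal (𝓞 L) (𝓞 L')) :
    Real.log (absNorm (differentIdeal (𝓞 L) (𝓞 L')) : ℝ) ≤
      (finrank ℚ L' : ℝ) * Real.log (N.natAbs : ℝ) := by
  have hle : Ideal.span {(N : 𝓞 L')} ≤ differentIdeal (𝓞 L) (𝓞 L') :=
    (Ideal.span_singleton_le_iff_mem _).mpr hmem
  have hdvd : absNorm (differentIdeal (𝓞 L) (𝓞 L')) ∣ absNorm (Ideal.span {(N : 𝓞 L')}) :=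
    Ideal.absNorm_dvd_absNorm_of_le hle
  have hspan : absNorm (Ideal.span {(N : 𝓞 L')}) = N.natAbs ^ finrank ℚ L' := by
    rw [Ideal.absNorm_span_singleton, show (N : 𝓞 L') = algebraMap ℤ (𝓞 L') N from
      (map_intCast (algebraMap ℤ (𝓞 L')) N).symm, Algebra.norm_algebraMap, Int.natAbs_pow,
      NumberField.RingOfIntegers.rank]
  have hpos : 0 < absNorm (Ideal.span {(N : 𝓞 L')}) := by
    rw [hspan]
    exact pow_pos (Int.natAbs_pos.mpr hN) _
  have hle' : (absNorm (differentIdeal (𝓞 L) (𝓞 L')) : ℝ) ≤ (N.natAbs : ℝ) ^ finrank ℚ L' := by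
    have := Nat.le_of_dvd hpos hdvd
    rw [hspan] at this
    exact_mod_cast this
  have hDpos : (0 : ℝ) < absNorm (differentIdeal (𝓞 L) (𝓞 L')) := by
    have h0 : absNorm (differentIdeal (𝓞 L) (𝓞 L')) ≠ 0 := by
      rw [Ne, Ideal.absNorm_eq_zero_iff]
      exact differentIdeal_ne_bot
    exact_mod_cast Nat.pos_of_ne_zero h0
  calc Real.log (absNorm (differentIdeal (𝓞 L) (𝓞 L')) : ℝ)
      ≤ Real.log ((N.natAbs : ℝ) ^ finrank ℚ L') := Real.log_le_log hDpos hle'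
    _ = (finrank ℚ L' : ℝ) * Real.log (N.natAbs : ℝ) := Real.log_pow _ _

/-- **The relative step.** If a nonzero integer `N` lies in `𝔇_{L'/L}`, then
`(1/[L':ℚ])·log|disc L'| ≤ (1/[L:ℚ])·log|disc L| + log N` (transitivity of the discriminant,
`log_natAbs_discr_eq`, and `[L':ℚ] = [L':L]·[L:ℚ]`). [cite: MochizukiGenEll2010, Prop 1.7 (i) p.10] -/
theorem logdisc_le_logdisc_add_of_int_mem_differentIdeal {N : ℤ} (hN : N ≠ 0)
    (hmem : (N : 𝓞 L') ∈ differentIdeal (𝓞 L) (𝓞 L')) :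
    (finrank ℚ L' : ℝ)⁻¹ * Real.log ((discr L').natAbs : ℝ) ≤
      (finrank ℚ L : ℝ)⁻¹ * Real.log ((discr L).natAbs : ℝ) + Real.log (N.natAbs : ℝ) := by
  have hL : (0 : ℝ) < finrank ℚ L := by exact_mod_cast finrank_pos
  have hLL' : (0 : ℝ) < finrank L L' := by exact_mod_cast finrank_pos
  have htower : (finrank ℚ L' : ℝ) = finrank ℚ L * finrank L L' := by
    exact_mod_cast (finrank_mul_finrank ℚ L L').symm
  have hL' : (0 : ℝ) < finrank ℚ L' := by rw [htower]; positivity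
  have hD := log_absNorm_differentIdeal_le L L' hN hmem
  rw [log_natAbs_discr_eq L L', mul_add, htower, mul_inv,
    show (finrank ℚ L : ℝ)⁻¹ * (finrank L L' : ℝ)⁻¹ * ((finrank L L' : ℝ) * Real.log ((discr L).natAbs)) =
      (finrank ℚ L : ℝ)⁻¹ * Real.log ((discr L).natAbs) by field_simp, add_comm]
  rw [htower] at hD
  have hprod : (0 : ℝ) < finrank ℚ L * finrank L L' := by positivity
  have key : (finrank ℚ L : ℝ)⁻¹ * (finrank L L' : ℝ)⁻¹ *
      Real.log (absNorm (differentIdeal (𝓞 L) (𝓞 L')) : ℝ) ≤ Real.log (N.natAbs : ℝ) := by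
    rw [← mul_inv, inv_mul_le_iff₀ hprod]
    exact hD
  linarith

end Different

/-! ### (3) The theorem: a constant depending on `μ` only -/

/-- **Log-discriminant of a simple extension by a root of a fixed polynomial.** For a monic `μ ∈ ℤ[X]`
that is separable over `ℚ` there is `D ∈ ℝ` (namely `log N` for the integer of
`exists_int_bezout_derivative`) such that for ALL number fields `L ⊆ L'` and `θ ∈ L'` with `μ(θ) = 0`
and `L' = L(θ)`: `(1/[L':ℚ])·log|disc L'| ≤ (1/[L:ℚ])·log|disc L| + D`.
[cite: MochizukiGenEll2010, Thm 2.1 p.12] [cite: NeukirchANT1999, Ch. III (2.4) p.197] -/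
theorem exists_logdisc_adjoin_root_le (μ : ℤ[X]) (hmonic : μ.Monic)
    (hsep : (μ.map (Int.castRingHom ℚ)).Separable) :
    ∃ D : ℝ, 0 ≤ D ∧ ∀ (L : Type*) [Field L] [NumberField L] (L' : Type*) [Field L'] [NumberField L']
      [Algebra L L'] (θ : L'), aeval θ μ = 0 → IntermediateField.adjoin L {θ} = ⊤ →
        (finrank ℚ L' : ℝ)⁻¹ * Real.log ((discr L').natAbs : ℝ) ≤
          (finrank ℚ L : ℝ)⁻¹ * Real.log ((discr L).natAbs : ℝ) + D := by
  obtain ⟨N, B, hN, hB⟩ := exists_int_bezout_derivative μ hsep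
  refine ⟨Real.log (N.natAbs : ℝ), Real.log_nonneg (by exact_mod_cast Int.natAbs_pos.mpr hN), ?_⟩
  intro L _ _ L' _ _ _ θ hθ htop
  -- `θ` is an algebraic integer
  have hθint : IsIntegral ℤ θ := ⟨μ, hmonic, by rwa [← aeval_def]⟩
  let θ' : 𝓞 L' := ⟨θ, hθint⟩
  have hθ' : aeval θ' μ = 0 := by
    apply Subtype.ext
    have h := Polynomial.aeval_algHom_apply (IsScalarTower.toAlgHom ℤ (𝓞 L') L') θ' μ
    change aeval θ μ = algebraMap (𝓞 L') L' (aeval θ' μ) at h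
    change ((aeval θ' μ : 𝓞 L') : L') = ((0 : 𝓞 L') : L')
    rw [show ((aeval θ' μ : 𝓞 L') : L') = algebraMap (𝓞 L') L' (aeval θ' μ) from rfl, ← h, hθ]
    rfl
  -- `N = B(θ)·μ'(θ) ∈ 𝔇_{L'/L}`
  have hmem : (N : 𝓞 L') ∈ differentIdeal (𝓞 L) (𝓞 L') := by
    have hprod : aeval θ' B * aeval θ' (derivative μ) = (N : 𝓞 L') := by
      apply Subtype.ext
      have hB' := hB L' θ hθ
      have h1 := Polynomial.aeval_algHom_apply (IsScalarTower.toAlgHom ℤ (𝓞 L') L') θ' B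
      have h2 := Polynomial.aeval_algHom_apply (IsScalarTower.toAlgHom ℤ (𝓞 L') L') θ'
        (derivative μ)
      change aeval θ B = algebraMap (𝓞 L') L' (aeval θ' B) at h1
      change aeval θ (derivative μ) = algebraMap (𝓞 L') L' (aeval θ' (derivative μ)) at h2
      change algebraMap (𝓞 L') L' (aeval θ' B * aeval θ' (derivative μ)) =
        algebraMap (𝓞 L') L' (N : 𝓞 L')
      rw [map_mul, ← h1, ← h2, hB', map_intCast]
    rw [← hprod]
    exact Ideal.mul_mem_left _ _
      (aeval_derivative_int_mem_differentIdeal L L' μ θ' hθ' (by exact htop))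
  exact logdisc_le_logdisc_add_of_int_mem_differentIdeal L L' hN hmem

/-- **`NFPoint` form** (the shape consumed by the GenEllTwo mechanism assembly): for the same fixed `μ`
and constant `D`, if the presenting field of `Q'` is an extension of that of `Q` generated by a root of
`μ`, then `log-diff(Q') ≤ log-diff(Q) + D` (`NFPoint.logDiff = (1/[F:ℚ])·log|disc F|`,
`logDiff_eq_log_discr`). [cite: MochizukiGenEll2010, Thm 2.1 p.12] -/
theorem exists_logDiff_adjoin_root_le (μ : ℤ[X]) (hmonic : μ.Monic)
    (hsep : (μ.map (Int.castRingHom ℚ)).Separable) :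
    ∃ D : ℝ, 0 ≤ D ∧ ∀ (Q Q' : NFPoint) [Algebra Q.F Q'.F] (θ : Q'.F), aeval θ μ = 0 →
      IntermediateField.adjoin Q.F {θ} = ⊤ → Q'.logDiff ≤ Q.logDiff + D := by
  obtain ⟨D, hD0, hD⟩ := exists_logdisc_adjoin_root_le μ hmonic hsep
  refine ⟨D, hD0, fun Q Q' _ θ hθ htop => ?_⟩
  rw [NFPoint.logDiff_eq_log_discr, NFPoint.logDiff_eq_log_discr]
  exact hD Q.F Q'.F θ hθ htop

end Literature.NumberTheory.DiophantineGeometry.GenEll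

end
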